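import Summits.CriticalPhenomena.PercolationContinuityZ3.Theorems.PercNearOneGluingNoHeavyLowerTailSunflowerGradedTBernHubPack
import Summits.CriticalPhenomena.PercolationContinuityZ3.Theorems.PercNearOneGluingNoHeavyLowerTailSunflowerGradedTBernMoves
import Summits.CriticalPhenomena.PercolationContinuityZ3.Theorems.PercNearOneGluingNoHeavyLowerTailSunflowerGradedTBernMerge
import Summits.CriticalPhenomena.PercolationContinuityZ3.Theorems.PercNearOneGluingNoHeavyLowerTailSunflowerTBernFinal
import HarnessLib

/-!
# `NoHeavyLowerTail` (crux stmt-CriticalPhenomena-4575), abstract sunflower cubic: **THE GRADED T-BERN INEQUALITY HOLDS**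
# (`gradedTBern_holds : GradedTBern s b β` for `0 < b ≤ β ≤ 1`, `0 ≤ s ≤ 1`)

Support file (seat `prim-ineq-prove-1` gen 69; `--supports stmt-CriticalPhenomena-4575`).  No `sorry`, no named facts, no
definitions, no conjecture-shaped hypotheses.  Memo: run/shared/lean/prim/prim-ineq-prove-1/FINDING-GRADED-prove1-g69.md.

`GradedTBern s b β` (`…SunflowerTwoLevelPendant`, gen 68) — the capped pendant inequality with the block budget tightened by a
phantom block `x ∈ [a₀,1]` — was one of the two analytic inequalities on which "every cycle `C_n`, `n ≥ 6`, has an A-safe core"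
is conditional (`safe_edgeCore_cycleGraph_of_inequalities`, `…SunflowerCycleSafe`); via `twoLevel_union_pendant` it is the
two-level Lemma A at a leaf.  **`gradedTBern_holds`** discharges it.

THE PROOF is T-BERN's (`…SunflowerTBernFinal`) with the phantom carried along (`…SunflowerGradedTBern{Scheme,Moves,Merge}`):
the same double induction (`domG_all`: number of petals, then `Σ petalWt`) runs the moves R1–R4 down to the irreducible
families, and **`domG_irreducible`** certifies those WITHOUT any (HC)-type machinery: an irreducible family is either aligned
(`domG_of_aligned`) or {hub `P` = the unique non-γ-heavy petal, γ-heavy x-type petals, at most one further γ-heavy petal `r`}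
(two non-x-type tight petals would be two h-petals, two T2 petals or an {h, leveraged T2} pair, all excluded), handled by
`domG_hub_pack` / `domG_hub_pack_r` (`…SunflowerGradedTBernHubPack`: `zone_extend_flex` + the elementary last step of
`…SunflowerGradedTBernEndgame`).  The case `s = 0` is aligned (every petal γ-light).
-/

noncomputable section

namespace Summit.CriticalPhenomena.PercolationContinuityZ3.Theorems.SunflowerPartition

namespace SafeCalc

namespace LinkedCurrency

open Finset Polynomial

variable {ι : Type*}

/-! ## Irreducible families -/

/-- **The graded certificate for irreducible families** (at most one slack petal, at most one tight rich petal, at most one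
h-petal, no {h-petal, leveraged T2} pair; `0 < b ≤ β ≤ 1`, `0 < s ≤ 1`, `x ∈ [a₀,1]`).  See the module docstring. [this work] -/
theorem domG_irreducible [DecidableEq ι] {s b β x : ℝ} (hb : 0 < b) (hbβ : b ≤ β) (hβ1 : β ≤ 1) (hs0 : 0 < s)
    (hs1 : s ≤ 1) (hax : (1 - s) * b + s * β ≤ x) (hx1 : x ≤ 1) {t : Finset ι} (ht : t.Nonempty) {u vv m : ι → ℝ}
    (hadm : AdmissibleG s b β x t u vv m)
    (hslack1 : ∀ i ∈ t, ∀ j ∈ t, m i < u i → m j < u j → i = j)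
    (hT1 : ∀ i ∈ t, ∀ j ∈ t, (m i = u i ∧ b < m i ∧ β < vv i) → (m j = u j ∧ b < m j ∧ β < vv j) → i = j)
    (hH1 : ∀ i ∈ t, ∀ j ∈ t, (u i = b ∧ m i = b ∧ β < vv i) → (u j = b ∧ m j = b ∧ β < vv j) → i = j)
    (hnolev : ∀ i ∈ t, ∀ j ∈ t, (u i = b ∧ m i = b ∧ β < vv i) → (m j = u j ∧ b < m j ∧ β < vv j) →
      b * vv j < β * m j) :
    DomG s b β x t u vv m := by
  have hβ : 0 < β := hb.trans_le hbβ
  obtain ⟨hub, hu1, hvβ, hv1, hmb, hmu, hmv, -, -, -⟩ := id hadm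
  by_cases hall : ∀ l ∈ t, ((1 - s) * b + s * β) * (s + (1 - s) * u l) ≤ (s + (1 - s) * b) * ((1 - s) * m l + s * vv l)
  · exact domG_of_aligned hb hbβ hs0.le hs1 hax hx1 ht hadm (Or.inl hall)
  push Not at hall
  obtain ⟨P, hP, hPlt⟩ := hall
  -- `P` is slack, hence the unique slack petal; everybody else is tight, hence γ-heavy
  have hPslack : m P < u P := by
    by_contra hnot
    have hmeq : m P = u P := le_antisymm (hmu P hP) (not_lt.1 hnot)
    exact absurd (gammaHeavy_of_tight hs0.le hs1 hb.le hβ1 (hub P hP) (hvβ P hP) hmeq) (not_le.2 hPlt)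
  have htight : ∀ l ∈ t, l ≠ P → m l = u l := by
    intro l hl hlP
    by_contra hne
    exact hlP (hslack1 l hl P hP (lt_of_le_of_ne (hmu l hl) hne) hPslack)
  have hheavy : ∀ l ∈ t, l ≠ P →
      ((1 - s) * b + s * β) * (s + (1 - s) * u l) ≤ (s + (1 - s) * b) * ((1 - s) * m l + s * vv l) :=
    fun l hl hlP => gammaHeavy_of_tight hs0.le hs1 hb.le hβ1 (hub l hl) (hvβ l hl) (htight l hl hlP)
  -- a tight petal which is not x-type (`b·g > a₀·u`) is strictly leveraged (`b·vv > β·m`), hence an h-petal or a rich T2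
  have hlev_of_not_x : ∀ l ∈ t, l ≠ P → ¬ b * ((1 - s) * m l + s * vv l) ≤ ((1 - s) * b + s * β) * u l →
      β * m l < b * vv l := by
    intro l hl hlP hnx
    have hml := htight l hl hlP
    by_contra hle
    push Not at hle
    apply hnx
    rw [hml]
    nlinarith [mul_le_mul_of_nonneg_left hle hs0.le]
  have hclass : ∀ l ∈ t, l ≠ P → ¬ b * ((1 - s) * m l + s * vv l) ≤ ((1 - s) * b + s * β) * u l →
      (u l = b ∧ m l = b ∧ β < vv l) ∨ (m l = u l ∧ b < m l ∧ β < vv l) := by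
    intro l hl hlP hnx
    have hlev := hlev_of_not_x l hl hlP hnx
    have hml := htight l hl hlP
    have hvl : β < vv l := by
      by_contra hle; push Not at hle
      have : b * vv l ≤ β * m l := by nlinarith [hmb l hl, hvβ l hl]
      linarith
    rcases eq_or_lt_of_le (hmb l hl) with hm' | hm'
    · exact Or.inl ⟨by rw [← hml, ← hm'], hm'.symm, hvl⟩
    · exact Or.inr ⟨hml, hm', hvl⟩
  -- at most one non-x-type petal besides `P`
  have huniq : ∀ i ∈ t, i ≠ P → ∀ j ∈ t, j ≠ P →
      ¬ b * ((1 - s) * m i + s * vv i) ≤ ((1 - s) * b + s * β) * u i →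
      ¬ b * ((1 - s) * m j + s * vv j) ≤ ((1 - s) * b + s * β) * u j → i = j := by
    intro i hi hiP j hj hjP hni hnj
    have hlevi := hlev_of_not_x i hi hiP hni
    have hlevj := hlev_of_not_x j hj hjP hnj
    rcases hclass i hi hiP hni with hhi | hTi <;> rcases hclass j hj hjP hnj with hhj | hTj
    · exact hH1 i hi j hj hhi hhj
    · exact absurd (hnolev i hi j hj hhi hTj) (not_lt.2 hlevj.le)
    · exact absurd (hnolev j hj i hi hhj hTi) (not_lt.2 hlevi.le)
    · exact hT1 i hi j hj hTi hTj
  by_cases hxall : ∀ l ∈ t, l ≠ P → b * ((1 - s) * m l + s * vv l) ≤ ((1 - s) * b + s * β) * u l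
  · -- {hub, x-type pack}
    exact domG_hub_pack hb hbβ hs0.le hs1 hax hx1 hadm hP fun j hj hjP => ⟨hheavy j hj hjP, hxall j hj hjP⟩
  · -- {hub, x-type pack, last petal `r`}
    push Not at hxall
    obtain ⟨r, hr, hrP, hrx⟩ := hxall
    refine domG_hub_pack_r hb hbβ hβ1 hs0.le hs1 hax hadm hP hr hrP (fun j hj hjP hjr => ⟨hheavy j hj hjP, ?_⟩)
      (hheavy r hr hrP)
    by_contra hjx
    exact hjr (huniq j hj hjP r hr hrP hjx (not_le.2 hrx))

/-! ## The main induction -/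

/-- **`DomG` for EVERY nonempty `AdmissibleG` family** (`0 < b ≤ β ≤ 1`, `0 < s ≤ 1`, `x ∈ [a₀, 1]`): the double induction of
`domOn_all` (`…SunflowerTBernFinal`) with the phantom block carried along. [this work] -/
theorem domG_all [DecidableEq ι] {s b β x : ℝ} (hb : 0 < b) (hbβ : b ≤ β) (hβ1 : β ≤ 1) (hs0 : 0 < s) (hs1 : s ≤ 1)
    (hax : (1 - s) * b + s * β ≤ x) (hx1 : x ≤ 1) :
    ∀ (n : ℕ) (t : Finset ι) (u vv m : ι → ℝ), t.card = n → t.Nonempty → AdmissibleG s b β x t u vv m →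
      DomG s b β x t u vv m := by
  have hs' : 0 ≤ 1 - s := sub_nonneg.2 hs1
  have hβ : 0 < β := hb.trans_le hbβ
  have ha₀ : 0 < (1 - s) * b + s * β := by nlinarith
  intro n
  induction n using Nat.strong_induction_on with
  | _ n ihn =>
  intro t u vv m hcard ht hadm
  have hE : CoefNonneg (C (1 : ℝ) * X + C x) := coefNonneg_lin zero_le_one (ha₀.le.trans hax)
  suffices inner : ∀ (M : ℕ) (u vv m : ι → ℝ), AdmissibleG s b β x t u vv m →
      ∑ l ∈ t, petalWt b β u vv m l = M → DomG s b β x t u vv m from inner _ u vv m hadm rfl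
  intro M
  induction M using Nat.strong_induction_on with
  | _ M ihM =>
  intro u vv m hadm hM
  obtain ⟨hub, hu1, hvβ, hv1, hmb, hmu, hmv, hpu, hpv, hpg⟩ := id hadm
  have hu0 : ∀ l ∈ t, 0 ≤ u l := fun l hl => hb.le.trans (hub l hl)
  have hm0 : ∀ l ∈ t, 0 ≤ m l := fun l hl => hb.le.trans (hmb l hl)
  have hv0 : ∀ l ∈ t, 0 ≤ vv l := fun l hl => hβ.le.trans (hvβ l hl)
  have hc0 : ∀ l ∈ t, 0 ≤ (1 - s) * m l + s * vv l := fun l hl =>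
    add_nonneg (mul_nonneg hs' (hm0 l hl)) (mul_nonneg hs0.le (hv0 l hl))
  -- R1: two slack petals
  by_cases hB : ∃ i ∈ t, ∃ j ∈ t, i ≠ j ∧ m i < u i ∧ m j < u j
  · obtain ⟨i, hi, j, hj, hij, hsi, hsj⟩ := hB
    have hui : 0 < u i := hb.trans_le (hub i hi)
    have huj : 0 < u j := hb.trans_le (hub j hj)
    have hmj : 0 < m j := hb.trans_le (hmb j hj)
    have hmi : 0 < m i := hb.trans_le (hmb i hi)
    set tlo := m i / u i with htlo
    set thi := u j / m j with hthi
    have hlo : 0 < tlo := div_pos hmi hui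
    have hlo1 : tlo ≤ 1 := (div_le_one hui).2 hsi.le
    have hhi : 1 ≤ thi := (one_le_div hmj).2 hsj.le
    have hilo : u i * tlo = m i := by rw [htlo]; field_simp
    have hjhi : u j / thi = m j := by rw [hthi]; field_simp
    -- the two endpoint families
    have hadm_lo := admissibleG_uExchange hs0.le hs1 hb hbβ hax hadm hij hi hj hlo (le_of_eq hilo.symm)
      (by nlinarith [hmu j hj] : m j * tlo ≤ u j)
    have hadm_hi := admissibleG_uExchange hs0.le hs1 hb hbβ hax hadm hij hi hj (by linarith)
      (by nlinarith [hmu i hi] : m i ≤ u i * thi) (by rw [hthi]; field_simp; exact le_rfl : m j * thi ≤ u j)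
    -- their measures drop
    have hM_lo : ∑ l ∈ t, petalWt b β (Function.update (Function.update u i (u i * tlo)) j (u j / tlo)) vv m l < M := by
      rw [← hM]
      refine sum_lt_of_pair hij hi hj (fun l _ hli hlj => petalWt_congr (uExchange_apply_other tlo hli hlj) rfl rfl) ?_
      have h1 : petalWt b β (Function.update (Function.update u i (u i * tlo)) j (u j / tlo)) vv m i ≤ 1 :=
        petalWt_le_one_of_tight (by rw [Function.update_of_ne hij, Function.update_self, hilo])
      have h2 : petalWt b β (Function.update (Function.update u i (u i * tlo)) j (u j / tlo)) vv m j = 2 :=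
        petalWt_of_slack (by rw [Function.update_self]; exact lt_of_lt_of_le hsj (le_div_self (hu0 j hj) hlo hlo1))
      rw [h2, petalWt_of_slack hsi, petalWt_of_slack hsj]; omega
    have hM_hi : ∑ l ∈ t, petalWt b β (Function.update (Function.update u i (u i * thi)) j (u j / thi)) vv m l < M := by
      rw [← hM]
      refine sum_lt_of_pair hij hi hj (fun l _ hli hlj => petalWt_congr (uExchange_apply_other thi hli hlj) rfl rfl) ?_
      have h1 : petalWt b β (Function.update (Function.update u i (u i * thi)) j (u j / thi)) vv m j ≤ 1 :=
        petalWt_le_one_of_tight (by rw [Function.update_self, hjhi])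
      have h2 : petalWt b β (Function.update (Function.update u i (u i * thi)) j (u j / thi)) vv m i = 2 :=
        petalWt_of_slack (by
          rw [Function.update_of_ne hij, Function.update_self]
          exact lt_of_lt_of_le hsi (le_mul_of_one_le_right (hu0 i hi) hhi))
      rw [h2, petalWt_of_slack hsi, petalWt_of_slack hsj]; omega
    have hdom_lo := ihM _ hM_lo _ _ _ hadm_lo rfl
    have hdom_hi := ihM _ hM_hi _ _ _ hadm_hi rfl
    intro k
    refine (coeff_uExchange_mul_le_max hs0.le hs1 hu0 hc0 hij hi hj hlo hlo1 hhi hE k).trans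
      (max_le (hdom_lo k) (hdom_hi k))
  -- R2: two tight rich petals
  by_cases hC : ∃ i ∈ t, ∃ j ∈ t, i ≠ j ∧ (m i = u i ∧ b < m i ∧ β < vv i) ∧ (m j = u j ∧ b < m j ∧ β < vv j)
  · obtain ⟨i, hi, j, hj, hij, ⟨hti, hbi, hvi⟩, ⟨htj, hbj, hvj⟩⟩ := hC
    have hmi : 0 < m i := hb.trans hbi
    have hmj : 0 < m j := hb.trans hbj
    have hvvi : 0 < vv i := hβ.trans hvi
    have hvvj : 0 < vv j := hβ.trans hvj
    set tlo := max (b / m i) (β / vv i) with htlo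
    set thi := min (m j / b) (vv j / β) with hthi
    have hlo : 0 < tlo := lt_max_of_lt_left (div_pos hb hmi)
    have hlo1 : tlo ≤ 1 := max_le ((div_le_one hmi).2 hbi.le) ((div_le_one hvvi).2 hvi.le)
    have hhi : 1 ≤ thi := le_min ((one_le_div hb).2 hbj.le) ((one_le_div hβ).2 hvj.le)
    have hthi0 : 0 < thi := lt_of_lt_of_le zero_lt_one hhi
    -- endpoint conditions
    have c1 : b ≤ m i * tlo := by
      calc b = m i * (b / m i) := by field_simp
        _ ≤ m i * tlo := mul_le_mul_of_nonneg_left (le_max_left _ _) hmi.le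
    have c2 : β ≤ vv i * tlo := by
      calc β = vv i * (β / vv i) := by field_simp
        _ ≤ vv i * tlo := mul_le_mul_of_nonneg_left (le_max_right _ _) hvvi.le
    have c3 : b * tlo ≤ m j := by nlinarith
    have c4 : β * tlo ≤ vv j := by nlinarith
    have d1 : b ≤ m i * thi := by nlinarith
    have d2 : β ≤ vv i * thi := by nlinarith
    have d3 : b * thi ≤ m j := by
      calc b * thi ≤ b * (m j / b) := mul_le_mul_of_nonneg_left (min_le_left _ _) hb.le
        _ = m j := by field_simp
    have d4 : β * thi ≤ vv j := by
      calc β * thi ≤ β * (vv j / β) := mul_le_mul_of_nonneg_left (min_le_right _ _) hβ.le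
        _ = vv j := by field_simp
    have hadm_lo := admissibleG_scale hs0.le hs1 hb hbβ hax hadm hij hi hj hlo c1 c2 c3 c4
    have hadm_hi := admissibleG_scale hs0.le hs1 hb hbβ hax hadm hij hi hj hthi0 d1 d2 d3 d4
    -- measures drop: the shrunk petal is no longer rich
    have hnr_lo : ¬ (b < m i * tlo ∧ β < vv i * tlo) := by
      rcases max_choice (b / m i) (β / vv i) with h | h
      · have : m i * tlo = b := by rw [htlo, h]; field_simp
        exact fun hh => absurd hh.1 (by rw [this]; exact lt_irrefl b)
      · have : vv i * tlo = β := by rw [htlo, h]; field_simp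
        exact fun hh => absurd hh.2 (by rw [this]; exact lt_irrefl β)
    have hnr_hi : ¬ (b < m j / thi ∧ β < vv j / thi) := by
      rcases min_choice (m j / b) (vv j / β) with h | h
      · have : m j / thi = b := by rw [hthi, h]; field_simp
        exact fun hh => absurd hh.1 (by rw [this]; exact lt_irrefl b)
      · have : vv j / thi = β := by rw [hthi, h]; field_simp
        exact fun hh => absurd hh.2 (by rw [this]; exact lt_irrefl β)
    have hM_lo : ∑ l ∈ t, petalWt b β (Function.update (Function.update u i (u i * tlo)) j (u j / tlo))
        (Function.update (Function.update vv i (vv i * tlo)) j (vv j / tlo))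
        (Function.update (Function.update m i (m i * tlo)) j (m j / tlo)) l < M := by
      rw [← hM]
      refine sum_lt_of_pair hij hi hj (fun l _ hli hlj => petalWt_congr (uExchange_apply_other tlo hli hlj)
        (uExchange_apply_other tlo hli hlj) (uExchange_apply_other tlo hli hlj)) ?_
      have h1 : petalWt b β (Function.update (Function.update u i (u i * tlo)) j (u j / tlo))
          (Function.update (Function.update vv i (vv i * tlo)) j (vv j / tlo))
          (Function.update (Function.update m i (m i * tlo)) j (m j / tlo)) i = 0 :=
        petalWt_of_tight_nonrich (by simp only [Function.update_of_ne hij, Function.update_self, hti])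
          (by simp only [Function.update_of_ne hij, Function.update_self]; exact hnr_lo)
      have h2 : petalWt b β (Function.update (Function.update u i (u i * tlo)) j (u j / tlo))
          (Function.update (Function.update vv i (vv i * tlo)) j (vv j / tlo))
          (Function.update (Function.update m i (m i * tlo)) j (m j / tlo)) j = 1 :=
        petalWt_of_rich (by simp only [Function.update_self, htj])
          (by simp only [Function.update_self]; exact lt_of_lt_of_le hbj (le_div_self hmj.le hlo hlo1))
          (by simp only [Function.update_self]; exact lt_of_lt_of_le hvj (le_div_self hvvj.le hlo hlo1))
      rw [h1, h2, petalWt_of_rich hti hbi hvi, petalWt_of_rich htj hbj hvj]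
    have hM_hi : ∑ l ∈ t, petalWt b β (Function.update (Function.update u i (u i * thi)) j (u j / thi))
        (Function.update (Function.update vv i (vv i * thi)) j (vv j / thi))
        (Function.update (Function.update m i (m i * thi)) j (m j / thi)) l < M := by
      rw [← hM]
      refine sum_lt_of_pair hij hi hj (fun l _ hli hlj => petalWt_congr (uExchange_apply_other thi hli hlj)
        (uExchange_apply_other thi hli hlj) (uExchange_apply_other thi hli hlj)) ?_
      have h1 : petalWt b β (Function.update (Function.update u i (u i * thi)) j (u j / thi))
          (Function.update (Function.update vv i (vv i * thi)) j (vv j / thi))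
          (Function.update (Function.update m i (m i * thi)) j (m j / thi)) j = 0 :=
        petalWt_of_tight_nonrich (by simp only [Function.update_self, htj])
          (by simp only [Function.update_self]; exact hnr_hi)
      have h2 : petalWt b β (Function.update (Function.update u i (u i * thi)) j (u j / thi))
          (Function.update (Function.update vv i (vv i * thi)) j (vv j / thi))
          (Function.update (Function.update m i (m i * thi)) j (m j / thi)) i = 1 :=
        petalWt_of_rich (by simp only [Function.update_of_ne hij, Function.update_self, hti])
          (by simp only [Function.update_of_ne hij, Function.update_self]
              exact lt_of_lt_of_le hbi (le_mul_of_one_le_right hmi.le hhi))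
          (by simp only [Function.update_of_ne hij, Function.update_self]
              exact lt_of_lt_of_le hvi (le_mul_of_one_le_right hvvi.le hhi))
      rw [h1, h2, petalWt_of_rich hti hbi hvi, petalWt_of_rich htj hbj hvj]
    have hdom_lo := ihM _ hM_lo _ _ _ hadm_lo rfl
    have hdom_hi := ihM _ hM_hi _ _ _ hadm_hi rfl
    intro k
    exact (coeff_scale_mul_le_max hs0.le hs1 hu0 hm0 hv0 hij hi hj hlo hlo1 hhi hE k).trans
      (max_le (hdom_lo k) (hdom_hi k))
  -- R3: two h-petals
  by_cases hD : ∃ i ∈ t, ∃ j ∈ t, i ≠ j ∧ (u i = b ∧ m i = b ∧ β < vv i) ∧ (u j = b ∧ m j = b ∧ β < vv j)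
  · obtain ⟨i, hi, j, hj, hij, ⟨hui, hmi, _⟩, ⟨huj, hmj, _⟩⟩ := hD
    set v' := (((1 - s) * b + s * vv i) * ((1 - s) * b + s * vv j) / ((1 - s) * b + s * β) - (1 - s) * b) / s with hv'd
    have hv' : ((1 - s) * b + s * β) * ((1 - s) * b + s * v') = ((1 - s) * b + s * vv i) * ((1 - s) * b + s * vv j) := by
      rw [hv'd]; field_simp; ring
    have hadm' := admissibleG_merge_h hb hbβ hs0 hs1 hax hadm hij hi hj hmi huj hmj hv'
    have hit' : i ∈ t.erase j := mem_erase.2 ⟨hij, hi⟩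
    have hcard' : (t.erase j).card < n := by rw [card_erase_of_mem hj, ← hcard]; exact Nat.sub_lt (card_pos.2 ht) one_pos
    have hdom' := ihn _ hcard' (t.erase j) _ _ _ rfl ⟨i, hit'⟩ hadm'
    exact domG_of_merge_h hb hbβ hs0 hs1 hax hadm hij hi hj hui hmi huj hmj hv' hdom'
  -- R4: an h-petal and a leveraged tight rich petal
  by_cases hE : ∃ i ∈ t, ∃ j ∈ t, (u i = b ∧ m i = b ∧ β < vv i) ∧ (m j = u j ∧ b < m j ∧ β < vv j) ∧ β * m j ≤ b * vv j
  · obtain ⟨i, hi, r, hr, ⟨hui, hmi, _⟩, ⟨hmr, hbr, _⟩, hlev⟩ := hE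
    have hri : r ≠ i := fun e => by rw [e, hmi] at hbr; exact lt_irrefl b hbr
    set v' := (((1 - s) * m r + s * vv r) * ((1 - s) * b + s * vv i) / ((1 - s) * b + s * β) - (1 - s) * m r) / s with hv'd
    have hv' : ((1 - s) * b + s * β) * ((1 - s) * m r + s * v') = ((1 - s) * m r + s * vv r) * ((1 - s) * b + s * vv i) := by
      rw [hv'd]; field_simp; ring
    have hadm' := admissibleG_merge_hT hb hbβ hs0 hs1 hax hadm hri hi hr hui hmi hlev hv'
    have hrt' : r ∈ t.erase i := mem_erase.2 ⟨hri, hr⟩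
    have hcard' : (t.erase i).card < n := by rw [card_erase_of_mem hi, ← hcard]; exact Nat.sub_lt (card_pos.2 ht) one_pos
    have hdom' := ihn _ hcard' (t.erase i) _ _ _ rfl ⟨r, hrt'⟩ hadm'
    exact domG_of_merge_hT hb hbβ hβ1 hs0 hs1 hax hadm hri hi hr hui hmi hmr hv' hdom'
  -- irreducible
  refine domG_irreducible hb hbβ hβ1 hs0 hs1 hax hx1 ht hadm ?_ ?_ ?_ ?_
  · intro i hi j hj hsi hsj
    by_contra hij
    exact hB ⟨i, hi, j, hj, hij, hsi, hsj⟩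
  · intro i hi j hj hri hrj
    by_contra hij
    exact hC ⟨i, hi, j, hj, hij, hri, hrj⟩
  · intro i hi j hj hhi hhj
    by_contra hij
    exact hD ⟨i, hi, j, hj, hij, hhi, hhj⟩
  · intro i hi j hj hhi hrj
    exact lt_of_not_ge fun hle => hE ⟨i, hi, j, hj, hhi, hrj, hle⟩


/-! ## The graded T-BERN inequality -/

/-- **THE GRADED T-BERN INEQUALITY HOLDS**: `GradedTBern s b β` for `0 < b ≤ β ≤ 1`, `0 ≤ s ≤ 1` — exactly the hypothesis
`hG` of `safe_edgeCore_cycleGraph_of_inequalities` (`…SunflowerCycleSafe`) and of `twoLevel_union_pendant`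
(`…SunflowerTwoLevelPendant`). [this work] -/
theorem gradedTBern_holds {s b β : ℝ} (hb : 0 < b) (hbβ : b ≤ β) (hβ1 : β ≤ 1) (hs0 : 0 ≤ s) (hs1 : s ≤ 1) :
    GradedTBern s b β := by
  classical
  refine gradedTBern_of_domG fun n x t u vv m hax hx1 hne hadm => ?_
  rcases eq_or_lt_of_le hs0 with hs00 | hspos
  · -- `s = 0`: every petal is γ-light, the family is aligned
    refine domG_of_aligned hb hbβ hs0 hs1 hax hx1 hne hadm (Or.inr fun j hj => ?_)
    obtain ⟨-, -, -, -, -, hmu, -⟩ := hadm.bounds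
    rw [← hs00]
    have := hmu j hj
    nlinarith
  · exact domG_all hb hbβ hβ1 hspos hs1 hax hx1 t.card t u vv m rfl hne hadm

/-- **The two-level Lemma A at a leaf, unconditionally** (`twoLevel_union_pendant_aSafe` with its `GradedTBern` hypothesis
discharged): for an A-safe up-set `A` not depending on `z`, `v ≠ z`, `μ(delMinor v A) > 0` at `p` with `0 < p v`... — recorded
here only through `gradedTBern_holds`; consumers instantiate `hG := fun s b β hb hbβ hβ1 hs0 hs1 => gradedTBern_holds hb hbβ hβ1 hs0 hs1`.
[this work] -/
theorem gradedTBern_forall : ∀ s b β : ℝ, 0 < b → b ≤ β → β ≤ 1 → 0 ≤ s → s ≤ 1 → GradedTBern s b β :=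
  fun _ _ _ hb hbβ hβ1 hs0 hs1 => gradedTBern_holds hb hbβ hβ1 hs0 hs1

end LinkedCurrency

end SafeCalc

end Summit.CriticalPhenomena.PercolationContinuityZ3.Theorems.SunflowerPartition
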